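import Summits.ResolutionOfSingularities.ResolutionOfSingularities.Theorems.FrobeniusClosingSteerGrConeForms
import Literature.AlgebraicGeometry.Resolution.MonomializationAlongValuation
import HarnessLib

/-!
# Crux `Steer` (stmt-ResolutionOfSingularities-16345), chain W4.1 — K-β0(b) gr bridge, brick (G3b):
# the quotient by the exceptional parameter, killing `V`, and the target congruence modulo `x₁`

OURS (campaign `res-hironaka`, rung L ★L-G4, slot W4.1; seat res-L0-w41-stub-4 g7 on res-L0-w41-plan-1 RULINGS 268(a)/282(f) «(G3) point-step cone
transport in gr currency»). Replaces the role of no printed item; NOT a statement of the manuscript under review [claim: Hironaka2017, status: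
under-review]; AI-produced, weaker than expert review. Theses-free, definition-free, words-free.

SETTING. `R′` regular local with `𝔪′ = (x₁, v₁, z₁, w₁)` of embedding dimension 4 (the member after a point step, `x₁` exceptional);
`R̄ = R′/(x₁)` (regular, embedding dimension 3, r.s.o.p. `(v̄₁, z̄₁, w̄₁)`, `gr = κ′[V, Z, W]`).
* §1 `aeval_kill_rename_succ`, `aeval_kill_X_zero_mul`, `eval_rename_succ` — binary forms read at `(Z, W)` inside `κ[V,Z,W]` and the
  substitution `V ↦ 0` («killing `V`»).
* §2 `card_quad_le`, `not_mem_sq_of_quad` — members of a 4-generator r.s.o.p. avoid `𝔪′²`.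
* §3 **`quotient_exc_param`** — `R̄` is regular local, `spanFinrank 𝔪̄ = 3`, `𝔪̄ = (v̄₁, z̄₁, w̄₁)`, `v̄₁ ≠ 0` (tree Matsumura 14.2
  `IsRegularLocalRing.quotient_span_singleton` + Nakayama `not_mem_sq_of_span_eq_maximalIdeal`).
* §4 `isUnit_add_of_mem_maximalIdeal`, `unitOrZero_map_mk` (coefficients «unit or ∈ (x₁)» become «unit or 0» in `R̄`), `map_bind₁_kill`,
  `bind₁_kill_rename_succ`, `bind₁_kill_X_zero_mul`.
* §5 **`target_congruence_quotient`** — the next stage's congruence `f₁ ≡ Ψ₁(z₁,w₁) (mod (x₁,v₁)·𝔪′^(d−1) + 𝔪′^(d+1))` read in `R̄`: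
  `f̄₁ ≡ (Ψ₁(Z,W) + V·H)(v̄,z̄,w̄) (mod 𝔪̄^(d+1))`.
The transport theorem itself is `…GrConeTransport` (part (G3c)).

[cite: Matsumura1987, Thm. 14.2] [cite: CossartJannsenSaito2020, §2.2] [folklore]
bears_on: LADDER-RESOLUTION L ★L-G4 W4.1 (crux `Steer`, binder hK4ⁿᶜ, K-β0(b) `ArithTransportTwoN`, gr bridge (G3)).
-/

noncomputable section

-- `Summit.<S>.<S>.…` duplicates the summit name by design (single-problem summit).
set_option linter.dupNamespace false

open IsLocalRing MvPolynomial
open Literature.RingTheory.HilbertSamuel Literature.AlgebraicGeometry.Resolution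

namespace Summit.ResolutionOfSingularities.ResolutionOfSingularities.Theorems.SwitchingDichotomy.NearPoint

universe u

/-! ## §1 Killing the first variable; embedding binary forms -/

section KillV
variable {k : Type u} [CommRing k]

/-- A binary form read in three variables `(V, Z, W)` at `(Z, W)` and then restricted to `V = 0` is itself. -/
theorem aeval_kill_rename_succ (P : MvPolynomial (Fin 2) k) :
    aeval (![0, X 0, X 1] : Fin 3 → MvPolynomial (Fin 2) k) (rename Fin.succ P) = P := by
  rw [aeval_rename]
  have : ((![0, X 0, X 1] : Fin 3 → MvPolynomial (Fin 2) k) ∘ Fin.succ) = X := by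
    funext i; fin_cases i <;> rfl
  rw [this, aeval_X_left]
  rfl

/-- Restricting a multiple of `V` to `V = 0` gives `0`. -/
theorem aeval_kill_X_zero_mul (H : MvPolynomial (Fin 3) k) :
    aeval (![0, X 0, X 1] : Fin 3 → MvPolynomial (Fin 2) k) (X 0 * H) = 0 := by
  rw [map_mul, aeval_X]
  simp

/-- Evaluating a binary form read in three variables. -/
theorem eval_rename_succ {A : Type u} [CommRing A] (y : Fin 3 → A) (P : MvPolynomial (Fin 2) A) :
    eval y (rename Fin.succ P) = eval ![y 1, y 2] P := by
  rw [eval_rename]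
  congr 2
  funext i; fin_cases i <;> rfl

end KillV

/-! ## §2 The quotient by the exceptional parameter -/

section Quotient
variable {R' : Type u} [CommRing R'] [IsLocalRing R']

omit [CommRing R'] [IsLocalRing R'] in
/-- Four generators have cardinality at most four. -/
theorem card_quad_le (x₁ v₁ z₁ w₁ : R') [DecidableEq R'] : ({x₁, v₁, z₁, w₁} : Finset R').card ≤ 4 := by
  refine (Finset.card_insert_le _ _).trans ?_
  refine Nat.succ_le_succ ((Finset.card_insert_le _ _).trans ?_)
  refine Nat.succ_le_succ ((Finset.card_insert_le _ _).trans ?_)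
  simp

/-- **A member of a 4-element generating set of `𝔪′` in a regular local ring of embedding dimension 4 is outside `𝔪′²`.** -/
theorem not_mem_sq_of_quad [IsNoetherianRing R'] (hfr : (maximalIdeal R').spanFinrank = 4) {x₁ v₁ z₁ w₁ : R'}
    (hspan : Ideal.span {x₁, v₁, z₁, w₁} = maximalIdeal R') {t : R'} (ht : t = x₁ ∨ t = v₁ ∨ t = z₁ ∨ t = w₁) :
    t ∉ maximalIdeal R' ^ 2 := by
  classical
  have hs : Ideal.span (({x₁, v₁, z₁, w₁} : Finset R') : Set R') = maximalIdeal R' := by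
    rw [← hspan]; congr 1; ext s; simp
  refine not_mem_sq_of_span_eq_maximalIdeal _ hs (by rw [hfr]; exact card_quad_le x₁ v₁ z₁ w₁) ?_
  simp only [Finset.mem_insert, Finset.mem_singleton]
  tauto

end Quotient

/-! ## §3 The quotient `R̄ = R′/(x₁)`: regular of embedding dimension 3 with r.s.o.p. `(v̄, z̄, w̄)` -/

section Rbar
variable {R' : Type u} [CommRing R'] [IsLocalRing R']

/-- **The quotient by the exceptional parameter**: for `R′` regular local with `𝔪′ = (x₁, v₁, z₁, w₁)` of embedding dimension 4,
`R̄ = R′/(x₁)` is regular local, `𝔪̄ = (v̄₁, z̄₁, w̄₁)` has embedding dimension 3, and `v̄₁ ≠ 0`. [cite: Matsumura1987, Thm. 14.2] -/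
theorem quotient_exc_param (hreg : IsRegularLocalRing R') (hfr : (maximalIdeal R').spanFinrank = 4) {x₁ v₁ z₁ w₁ : R'}
    (hspan : Ideal.span {x₁, v₁, z₁, w₁} = maximalIdeal R') :
    haveI : Nontrivial (R' ⧸ Ideal.span {x₁}) :=
      Ideal.Quotient.nontrivial_iff.mpr (Ideal.span_singleton_ne_top (fun h => (mem_maximalIdeal x₁).mp
        (hspan ▸ Ideal.subset_span (by simp)) h))
    haveI := IsLocalRing.of_surjective' (Ideal.Quotient.mk (Ideal.span {x₁})) Ideal.Quotient.mk_surjective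
    IsRegularLocalRing (R' ⧸ Ideal.span {x₁}) ∧ (maximalIdeal (R' ⧸ Ideal.span {x₁})).spanFinrank = 3 ∧
      Ideal.span (Set.range ![Ideal.Quotient.mk (Ideal.span {x₁}) v₁, Ideal.Quotient.mk (Ideal.span {x₁}) z₁,
        Ideal.Quotient.mk (Ideal.span {x₁}) w₁]) = maximalIdeal (R' ⧸ Ideal.span {x₁}) ∧
      Ideal.Quotient.mk (Ideal.span {x₁}) v₁ ≠ 0 := by
  classical
  haveI := hreg
  have hx₁ : x₁ ∈ maximalIdeal R' := hspan ▸ Ideal.subset_span (by simp)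
  have hx₁u : x₁ ∈ nonunits R' := (mem_maximalIdeal x₁).mp hx₁
  haveI hnt : Nontrivial (R' ⧸ Ideal.span {x₁}) := Ideal.Quotient.nontrivial_iff.mpr (Ideal.span_singleton_ne_top hx₁u)
  haveI := IsLocalRing.of_surjective' (Ideal.Quotient.mk (Ideal.span {x₁})) Ideal.Quotient.mk_surjective
  have hx₁sq : x₁ ∉ maximalIdeal R' ^ 2 := not_mem_sq_of_quad hfr hspan (Or.inl rfl)
  obtain ⟨hregbar, -⟩ := IsRegularLocalRing.quotient_span_singleton hx₁ hx₁sq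
  have hfr' := IsRegularLocalRing.spanFinrank_maximalIdeal_quotient_span_singleton hx₁ hx₁sq
  rw [hfr] at hfr'
  have hfrbar : (maximalIdeal (R' ⧸ Ideal.span {x₁})).spanFinrank = 3 := by omega
  set π := Ideal.Quotient.mk (Ideal.span {x₁}) with hπ
  have hπx : π x₁ = 0 := Ideal.Quotient.eq_zero_iff_mem.mpr (Ideal.subset_span rfl)
  have hmax : maximalIdeal (R' ⧸ Ideal.span {x₁}) = Ideal.span (Set.range ![π v₁, π z₁, π w₁]) := by
    rw [maximalIdeal_quotient_eq_map (Ideal.span {x₁}), ← hspan, Ideal.map_span]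
    have hr : Set.range ![π v₁, π z₁, π w₁] = {π v₁, π z₁, π w₁} := by
      ext t; simp only [Set.mem_range, Set.mem_insert_iff, Set.mem_singleton_iff]
      constructor
      · rintro ⟨i, rfl⟩; fin_cases i <;> simp
      · rintro (rfl | rfl | rfl); exacts [⟨0, rfl⟩, ⟨1, rfl⟩, ⟨2, rfl⟩]
    rw [hr, Set.image_insert_eq, Set.image_insert_eq, Set.image_insert_eq, Set.image_singleton, hπx, Ideal.span_insert_zero]
  refine ⟨hregbar, hfrbar, hmax.symm, ?_⟩
  -- `v̄₁ ∉ 𝔪̄²`, in particular `v̄₁ ≠ 0`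
  have hs : Ideal.span (({π v₁, π z₁, π w₁} : Finset (R' ⧸ Ideal.span {x₁})) : Set _) = maximalIdeal (R' ⧸ Ideal.span {x₁}) := by
    rw [hmax]; congr 1; ext t
    simp only [Finset.coe_insert, Finset.coe_singleton, Set.mem_insert_iff, Set.mem_singleton_iff, Set.mem_range]
    constructor
    · rintro (rfl | rfl | rfl); exacts [⟨0, rfl⟩, ⟨1, rfl⟩, ⟨2, rfl⟩]
    · rintro ⟨i, rfl⟩; fin_cases i <;> simp
  have hcard : ({π v₁, π z₁, π w₁} : Finset (R' ⧸ Ideal.span {x₁})).card ≤ (maximalIdeal (R' ⧸ Ideal.span {x₁})).spanFinrank := by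
    rw [hfrbar]
    refine (Finset.card_insert_le _ _).trans (Nat.succ_le_succ ((Finset.card_insert_le _ _).trans ?_))
    simp
  have hv := not_mem_sq_of_span_eq_maximalIdeal _ hs hcard (x := π v₁) (by simp)
  intro h0
  exact hv (by rw [h0]; exact zero_mem _)

end Rbar

/-! ## §4 Helpers: units, unit-or-zero coefficients under the quotient map, killing `V` under base change -/

section Helpers
variable {A : Type u} [CommRing A] [IsLocalRing A]

/-- A unit plus an element of the maximal ideal is a unit. -/
theorem isUnit_add_of_mem_maximalIdeal {u m : A} (hu : IsUnit u) (hm : m ∈ maximalIdeal A) : IsUnit (u + m) := by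
  obtain ⟨u, rfl⟩ := hu
  have h1 : IsUnit (1 - (-(↑u⁻¹ * m))) :=
    isUnit_one_sub_self_of_mem_nonunits _ ((mem_maximalIdeal _).mp (neg_mem (Ideal.mul_mem_left _ _ hm)))
  have : (u : A) + m = u * (1 - (-(↑u⁻¹ * m))) := by
    rw [sub_neg_eq_add, mul_add, mul_one, ← mul_assoc, Units.mul_inv, one_mul]
  rw [this]
  exact (Units.isUnit u).mul h1

omit [IsLocalRing A] in
/-- Coefficients «unit or in `I`» become «unit or zero» modulo `I`. -/
theorem unitOrZero_map_mk {σ : Type*} (I : Ideal A) (F : MvPolynomial σ A) (hF : ∀ m, IsUnit (coeff m F) ∨ coeff m F ∈ I) :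
    ∀ m, IsUnit (coeff m (MvPolynomial.map (Ideal.Quotient.mk I) F)) ∨ coeff m (MvPolynomial.map (Ideal.Quotient.mk I) F) = 0 := by
  intro m
  rw [coeff_map]
  rcases hF m with hu | hI
  · exact Or.inl (hu.map _)
  · exact Or.inr (Ideal.Quotient.eq_zero_iff_mem.mpr hI)

/-- Killing `V` commutes with a change of coefficients. -/
theorem map_bind₁_kill {k k' : Type u} [CommRing k] [CommRing k'] (g : k →+* k') (P : MvPolynomial (Fin 3) k) :
    MvPolynomial.map g (bind₁ (![0, X 0, X 1] : Fin 3 → MvPolynomial (Fin 2) k) P) =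
      bind₁ (![0, X 0, X 1] : Fin 3 → MvPolynomial (Fin 2) k') (MvPolynomial.map g P) := by
  rw [map_bind₁]
  congr 2
  funext i; fin_cases i <;> simp

/-- Killing `V` on a binary form read at `(Z, W)`. -/
theorem bind₁_kill_rename_succ {k : Type u} [CommRing k] (P : MvPolynomial (Fin 2) k) :
    bind₁ (![0, X 0, X 1] : Fin 3 → MvPolynomial (Fin 2) k) (rename Fin.succ P) = P := by
  rw [← aeval_eq_bind₁]; exact aeval_kill_rename_succ P

/-- Killing `V` on a multiple of `V`. -/
theorem bind₁_kill_X_zero_mul {k : Type u} [CommRing k] (H : MvPolynomial (Fin 3) k) :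
    bind₁ (![0, X 0, X 1] : Fin 3 → MvPolynomial (Fin 2) k) (X 0 * H) = 0 := by
  rw [← aeval_eq_bind₁]; exact aeval_kill_X_zero_mul H

end Helpers

/-! ## §5 The target congruence modulo `x₁` -/

section Target
variable {R' : Type u} [CommRing R'] [IsLocalRing R']

/-- **The next stage's congruence read in `R̄ = R′/(x₁)`**: `f₁ ≡ Ψ₁(z₁,w₁) (mod (x₁,v₁)·𝔪′^(d−1) + 𝔪′^(d+1))` gives
`f̄₁ ≡ (Ψ₁(Z,W) + V·H)(v̄,z̄,w̄) (mod 𝔪̄^(d+1))` for a form `H` of degree `d − 1` over `R̄`. -/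
theorem target_congruence_quotient {x₁ v₁ z₁ w₁ f₁ : R'} {d : ℕ} (Ψ₁ : MvPolynomial (Fin 2) R')
    (hcong : f₁ - eval ![z₁, w₁] Ψ₁ ∈ Ideal.span {x₁, v₁} * maximalIdeal R' ^ (d - 1) ⊔ maximalIdeal R' ^ (d + 1))
    [IsLocalRing (R' ⧸ Ideal.span {x₁})]
    (hyb : Ideal.span (Set.range ![Ideal.Quotient.mk (Ideal.span {x₁}) v₁, Ideal.Quotient.mk (Ideal.span {x₁}) z₁,
      Ideal.Quotient.mk (Ideal.span {x₁}) w₁]) = maximalIdeal (R' ⧸ Ideal.span {x₁})) :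
    ∃ H : MvPolynomial (Fin 3) (R' ⧸ Ideal.span {x₁}), H.IsHomogeneous (d - 1) ∧
      Ideal.Quotient.mk (Ideal.span {x₁}) f₁ -
          eval ![Ideal.Quotient.mk (Ideal.span {x₁}) v₁, Ideal.Quotient.mk (Ideal.span {x₁}) z₁, Ideal.Quotient.mk (Ideal.span {x₁}) w₁]
            (rename Fin.succ (MvPolynomial.map (Ideal.Quotient.mk (Ideal.span {x₁})) Ψ₁) + X 0 * H) ∈
        maximalIdeal (R' ⧸ Ideal.span {x₁}) ^ (d + 1) := by
  set π := Ideal.Quotient.mk (Ideal.span {x₁}) with hπ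
  set yb : Fin 3 → R' ⧸ Ideal.span {x₁} := ![π v₁, π z₁, π w₁] with hybdef
  have hπx : π x₁ = 0 := Ideal.Quotient.eq_zero_iff_mem.mpr (Ideal.subset_span rfl)
  have hπmax : (maximalIdeal R').map π ≤ maximalIdeal (R' ⧸ Ideal.span {x₁}) := by
    haveI : IsLocalHom π := IsLocalHom.of_surjective _ Ideal.Quotient.mk_surjective
    exact ((IsLocalRing.local_hom_TFAE π).out 0 2).mp ‹_›
  obtain ⟨p, hp, q, hq, hpq⟩ := Submodule.mem_sup.mp hcong
  -- the `(x₁,v₁)·𝔪′^(d−1)` part becomes `v̄ · m̄`, `m̄ ∈ 𝔪̄^(d−1)`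
  have hp' : π p ∈ Ideal.span {π v₁} * maximalIdeal (R' ⧸ Ideal.span {x₁}) ^ (d - 1) := by
    have h := Ideal.mem_map_of_mem π hp
    rw [Ideal.map_mul, Ideal.map_pow, Ideal.map_span, Set.image_insert_eq, Set.image_singleton, hπx, Ideal.span_insert_zero] at h
    exact Ideal.mul_mono_right (Ideal.pow_right_mono hπmax _) h
  obtain ⟨m, hm, hvm⟩ := Ideal.mem_span_singleton_mul.mp hp'
  rw [← hyb] at hm
  obtain ⟨H, hH, hHm⟩ := exists_isHomogeneous_of_mem_span_pow yb (d - 1) hm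
  refine ⟨H, hH, ?_⟩
  have hq' : π q ∈ maximalIdeal (R' ⧸ Ideal.span {x₁}) ^ (d + 1) := by
    have h := Ideal.mem_map_of_mem π hq
    rw [Ideal.map_pow] at h
    exact Ideal.pow_right_mono hπmax _ h
  have hev : eval yb (rename Fin.succ (MvPolynomial.map π Ψ₁)) = π (eval ![z₁, w₁] Ψ₁) := by
    rw [eval_rename_succ, MvPolynomial.eval_map, MvPolynomial.eval₂_comp]
    congr 1
    funext i; fin_cases i <;> rfl
  have : π f₁ - eval yb (rename Fin.succ (MvPolynomial.map π Ψ₁) + X 0 * H) = π q := by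
    rw [map_add, hev, map_mul, eval_X, hHm]
    change π f₁ - (π (eval ![z₁, w₁] Ψ₁) + π v₁ * m) = π q
    rw [hvm, ← map_add π, ← map_sub, show f₁ - (eval ![z₁, w₁] Ψ₁ + p) = q by rw [← sub_sub, ← hpq, add_sub_cancel_left]]
  rw [this]
  exact hq'

end Target
end Summit.ResolutionOfSingularities.ResolutionOfSingularities.Theorems.SwitchingDichotomy.NearPoint

end
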